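import Literature.NumberTheory.EllipticCurves.Gamma1ParametrizationCuspGaloisAction
import Mathlib.NumberTheory.Cyclotomic.Basic
import Mathlib.FieldTheory.Galois.Basic
import Mathlib.RingTheory.RootsOfUnity.Complex
import Mathlib.FieldTheory.Normal.Defs
import HarnessLib

/-!
# Stevens 1982 Thm. 1.3.1 (a)+(b) at the cusps `1/y`: the cyclotomic form IMPLIES the `Aut(ℂ/ℚ)` form (proofs file)

Companion of `Gamma1ParametrizationCuspGaloisAction.lean`, which holds the two named facts
`optimalGamma1Parametrization_cuspInv_cyclotomic_galois` (T-es-75♭: the printed `Gal(ℚ(ζ_N)/ℚ)` form, with part (a)) and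
`optimalGamma1Parametrization_cuspInv_galoisAction` (T-es-75: the `Aut_ℚ(ℂ)` form).  PROVED here:
`optimalGamma1Parametrization_cuspInv_galoisAction_of_cyclotomic : cyclotomic form → Aut(ℂ/ℚ) form`, by restricting `σ ∈ Aut_ℚ(ℂ)` to the
normal subfield `ℚ(ζ_N) ⊂ ℂ` (`AlgEquiv.restrictNormal`) and reading the exponent `d` modulo `N`.  Consequence for the fact ledger: of the
two named facts only the cyclotomic one need be registered as an input — the `Aut(ℂ/ℚ)` form is a theorem modulo it (the converse would
need the extension of `τ_d` to an automorphism of `ℂ` AND part (a); not done here).  No new fact, no definition; net debt 0.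

TYPER NOTE (typer g21).  SOURCE = the refuter's kernel-checked consistency lemma HOME/ref1/e222/CycloToAut.lean sha16 2f3e7d947f1e0e33
(ref1 g23 §R222; farm rc 0·0·0·0, std axioms; «positive lemma: NOT landed by the refuter — yours to land»), VERBATIM with exactly these
deltas: namespace `Ref1R222` → `Literature.NumberTheory.EllipticCurves.ModularForms` (next to the two facts); the two helpers
(`isCyclotomicExtension_cyclotomicSubfield'` — a replay of es g39's Summits-side `KummerDiamond.isCyclotomicExtension_cyclotomicSubfield`,
p760693, which a Literature file cannot import — and `exp_two_pi_I_mul_int_div_eq_pow`) made `private` (Literature plumbing; the public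
statement of the first already lives Summits-side); the import of `ModularParametrizationCuspGalois` dropped (now transitively imported by
the facts file); the trailing `#assert_std_axioms` commands dropped (the gate audits axioms); cite tags; this docstring.
[cite: Stevens1982, §1.3 Thm. 1.3.1 (a), (b) (p. 13)]
-/

noncomputable section

open scoped MatrixGroups ModularForm
open CongruenceSubgroup Complex WeierstrassCurve
open Literature.NumberTheory.EllipticCurves Literature.NumberTheory.EllipticCurves.ModularForms

namespace Literature.NumberTheory.EllipticCurves.ModularForms

/-- `ℚ(ζ_N) ⊂ ℂ` is an `N`-th cyclotomic extension of `ℚ` (es g39's three-line proof, replayed here so that this file depends on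
Literature modules only; the tree copy is `KummerDiamond.isCyclotomicExtension_cyclotomicSubfield`, p760693). [folklore] -/
private theorem isCyclotomicExtension_cyclotomicSubfield' (N : ℕ) [NeZero N] :
    IsCyclotomicExtension {N} ℚ (cyclotomicSubfield N) := by
  have hζ : IsPrimitiveRoot (rootOfUnityExp N) N := Complex.isPrimitiveRoot_exp N (NeZero.ne N)
  have hint : IsIntegral ℚ (rootOfUnityExp N) := (hζ.isIntegral (NeZero.pos N)).tower_top
  change IsCyclotomicExtension {N} ℚ (IntermediateField.adjoin ℚ {rootOfUnityExp N}).toSubalgebra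
  rw [IntermediateField.adjoin_simple_toSubalgebra_of_isAlgebraic hint.isAlgebraic]
  exact hζ.adjoin_isCyclotomicExtension ℚ

/-- `e^{2πi d/N} = ζ_N^{d mod N}` with a natural-number exponent (`ζ_N = rootOfUnityExp N`). [folklore] -/
private theorem exp_two_pi_I_mul_int_div_eq_pow (N : ℕ) [NeZero N] (d : ℤ) :
    Complex.exp (2 * Real.pi * Complex.I * d / N) = rootOfUnityExp N ^ (d % (N : ℤ)).toNat := by
  have hN0 : (N : ℤ) ≠ 0 := by exact_mod_cast NeZero.ne N
  have hζ : IsPrimitiveRoot (rootOfUnityExp N) N := Complex.isPrimitiveRoot_exp N (NeZero.ne N)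
  have hne : rootOfUnityExp N ≠ 0 := Complex.exp_ne_zero _
  have h1 : Complex.exp (2 * Real.pi * Complex.I * d / N) = rootOfUnityExp N ^ d := by
    rw [rootOfUnityExp, ← Complex.exp_int_mul]; congr 1; ring
  have h2 : (((d % (N : ℤ)).toNat : ℕ) : ℤ) = d % N := Int.toNat_of_nonneg (Int.emod_nonneg d hN0)
  rw [h1, ← zpow_natCast, h2]
  have h3 : rootOfUnityExp N ^ (d - d % (N : ℤ)) = 1 := by
    rw [hζ.zpow_eq_one_iff_dvd]
    exact ⟨d / N, by rw [Int.emod_def]; ring⟩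
  calc rootOfUnityExp N ^ d = rootOfUnityExp N ^ (d % (N : ℤ) + (d - d % (N : ℤ))) := by ring_nf
    _ = rootOfUnityExp N ^ (d % (N : ℤ)) := by rw [zpow_add₀ hne, h3, mul_one]

/-- **T-es-75♭ ⟹ T-es-75** (restriction of `σ ∈ Aut_ℚ(ℂ)` to the normal subfield `ℚ(ζ_N)`). [cite: Stevens1982, §1.3 Thm. 1.3.1 (a), (b) (p. 13) — the two renderings of one printed theorem] (restriction: Mathlib `AlgEquiv.restrictNormal` — `ℚ(ζ_N)/ℚ` is normal) -/
theorem optimalGamma1Parametrization_cuspInv_galoisAction_of_cyclotomic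
    (h : optimalGamma1Parametrization_cuspInv_cyclotomic_galois) :
    optimalGamma1Parametrization_cuspInv_galoisAction := by
  intro W _ N _ D hD σ d d' hdd' hσ y hy
  haveI : IsCyclotomicExtension {N} ℚ (cyclotomicSubfield N) := isCyclotomicExtension_cyclotomicSubfield' N
  haveI : IsGalois ℚ (cyclotomicSubfield N) := IsCyclotomicExtension.isGalois {N} ℚ (cyclotomicSubfield N)
  obtain ⟨P, hP, hGal⟩ := h W D hD y hy
  -- restrict `σ` to `ℚ(ζ_N)`
  set τ : cyclotomicSubfield N ≃ₐ[ℚ] cyclotomicSubfield N := σ.restrictNormal (cyclotomicSubfield N) with hτdef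
  have hτ : ∀ x : cyclotomicSubfield N, ((τ x : cyclotomicSubfield N) : ℂ) = σ (x : ℂ) := fun x =>
    AlgEquiv.restrictNormal_commutes σ (cyclotomicSubfield N) x
  -- the exponent `d` as a natural number
  set d₀ : ℕ := (d % (N : ℤ)).toNat with hd₀def
  have hd₀ : (d₀ : ℤ) = d % N :=
    Int.toNat_of_nonneg (Int.emod_nonneg d (by exact_mod_cast NeZero.ne N))
  have hmod : (d₀ : ℤ) * d' ≡ 1 [ZMOD N] := by
    have h1 : d * d' ≡ 1 [ZMOD N] := by
      rw [← Int.cast_one (R := ZMod N)] at hdd'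
      exact (ZMod.intCast_eq_intCast_iff _ _ _).mp hdd'
    rw [hd₀]
    exact ((Int.mod_modEq d N).mul_right d').trans h1
  have hτζ : ((τ (zetaGen N) : cyclotomicSubfield N) : ℂ) = rootOfUnityExp N ^ d₀ := by
    rw [hτ, show ((zetaGen N : cyclotomicSubfield N) : ℂ) = rootOfUnityExp N from rfl, rootOfUnityExp, hσ]
    exact exp_two_pi_I_mul_int_div_eq_pow N d
  have key := hGal d₀ d' hmod τ hτζ
  -- compare `σ ∘ ι` and `ι ∘ τ` on points, coordinatewise
  have hpt : Affine.Point.map (W' := W) (σ : ℂ →ₐ[ℚ] ℂ) (Affine.Point.baseChange (W' := W) (cyclotomicSubfield N) ℂ P) =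
      Affine.Point.baseChange (W' := W) (cyclotomicSubfield N) ℂ
        (Affine.Point.map (W' := W) (τ : cyclotomicSubfield N →ₐ[ℚ] cyclotomicSubfield N) P) := by
    rcases P with _ | @⟨x, y, hxy⟩
    · rfl
    · simp only [Affine.Point.map_some, Affine.Point.some.injEq]
      exact ⟨(hτ x).symm, (hτ y).symm⟩
  rw [← hP, hpt]
  exact key

end Literature.NumberTheory.EllipticCurves.ModularForms

end
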